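import Mathlib.Analysis.SpecialFunctions.Log.Basic
import Mathlib.Analysis.SpecialFunctions.Sqrt
import Literature.Analysis.FunctionSpaces.FlatTorus
import Literature.Analysis.FunctionSpaces.TorusCalculus
import Literature.Analysis.FunctionSpaces.TorusFluidGlue
import Literature.Analysis.FunctionSpaces.TorusClassicalNSUniqueness
import Literature.Analysis.FluidPDE.NSWave0
import Literature.Analysis.FluidPDE.TaoLocalisation
import Literature.Claims.NS.ClayVariants
import Literature.Claims.NS.ClayTorusMeanZeroBridge
import HarnessLib

/-!
# Claim skeleton (D-0090 NS-CLAIMS, C87, T3 QUICK tranche): Harbeck, Zenodo 17617470 v1 (2025) — «Global regularity on 𝕋³ and ℝ³ for arbitrary H¹ data», Theorems 1.1 / 1.4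

Typed skeleton (ns-claims-typist-7 g2; RULINGS v1.29l (4), QUICK statement grain) of William Harbeck,
*Global Regularity for the Three-Dimensional Navier–Stokes Equations via Equilibrium Depletion and
Universal Frequency Envelopes*, Zenodo record **17617470 version 1** (2025-11-15),
doi:10.5281/zenodo.17617470, 498 pp. (bib `Harbeck2025`; PDF page = printed page; open copy of SSRN
5754523; pages `pub/ns-claims/sources/Harbeck2025/Zenodo-17617470-v1/pages/pNNN.txt`, LOCATORS.md by
ns-claims-lit-1 g5). UNREFEREED CLAIM under adjudication — NOTHING in this file asserts a step of the
paper: its statements are `def … : Prop`; the `theorem`s are kernel-checked relations between them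
(composition, Clay links, one uniqueness transport). Card `pub/ns-claims/claims/Harbeck2025/CARD.md`
(PREDICTION §4 frozen 2026-08-27T01:43Z, sha16 28dd6ba71fd41da9).

## The claimed statements (verbatim)

**Theorem 1.1 (Global regularity on 𝕋³), p.20** (= Theorem 20.1 p.328): «Let u₀ ∈ H¹_σ(T³) be
arbitrary initial data with ∇·u₀ = 0 and zero mean. Then the Navier–Stokes system (1.1) [p.14:
∂ₜu + (u·∇)u = −∇p + νΔu, ∇·u = 0, u(x,0) = u₀(x)] on T³ × [0, ∞) admits a unique global smooth
solution u satisfying: (i) u ∈ C([0, ∞); H¹_σ(T³)) ∩ L∞([0, ∞); H¹_σ(T³)), (ii) u ∈ L²_loc([0, ∞);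
H²_σ(T³)), (iii) u ∈ C∞(T³ × (0, ∞)), (iv) u depends continuously on u₀ in the H¹ topology.
Moreover, there exists a universal constant γ > 0 (depending only on ν) such that
d/dt ‖u‖²_{H¹} ≤ −γ ‖u‖²_{H¹} log(e + ‖u‖_{H¹}). (1.17)» (H^s = inhomogeneous Sobolev space, p.24.)
**Theorem 1.4 (Global regularity on ℝ³), p.21**: «Let u₀ ∈ H¹_σ(R³) be arbitrary initial data with
∇·u₀ = 0, with no assumptions on decay, spatial localization, compactness, or smallness. Then the
Navier–Stokes system (1.1) on R³ × [0, ∞) admits a unique global smooth solution satisfying the same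
regularity properties as in Theorem 1.1». Remark 1.2 p.20 / Remark 20.2 p.329: «resolves the Clay
Millennium Problem P3».

TYPED (QUICK grain, smooth data — the H¹-data, continuity (i)/(iv) and uniqueness clauses are recorded,
not typed): `ClaimedTheoremT3` = for every `ν > 0` THERE IS `γ > 0` such that every smooth
divergence-free zero-mean datum on the unit torus has a global classical solution `(u, p)` on `[0,∞)`
with `u(0) = u₀`, `sup_{t ≥ 0} ‖u(t)‖²_{H¹} < ∞` ((i), L∞-part) AND the decay inequality (1.17) at
every `t > 0` (`OsgoodDecay γ u`; quantifier order «universal γ depending only on ν» ⇒ `∃ γ` BEFORE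
`∀ u₀`); `Thm11Existence` = the same without (1.17) (the (B)-shaped core); `ClaimedTheoremR3` =
Theorem 1.4 at the Clay grain (smooth divergence-free datum with `u₀, Du₀ ∈ L²`; conclusion: smooth
`(u,p)` on `ℝ³ × [0,∞)` solving (1)–(3) with bounded energy).

## Clay links (CARD §3) — PROVED: not a «wrong problem» row
`clayB_of_thm11 : Thm11Existence → clayPeriodic.Regularity` (tree bridge
`clayPeriodic_regularity_of_torus_meanZero`: lift to `ℝ³`-periodic fields + Galilean normalisation
of the mean); `thm11_of_claimedT3`; `clayA_of_claimedR3 : ClaimedTheoremR3 → clayR3.Regularity` (Clay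
data are `H¹`: `HasRapidSpatialDecay.lintegral_enorm_iteratedFDeriv_sq_lt_top`). Deltas: domain =
(𝕋³ resp. ℝ³) · f ≡ 0 = · data H¹ ⊇ (8)/(4) · solution class ⊇ (10)(11)/(6)(7) · horizon [0,∞) = ·
ν > 0 arbitrary = · zero mean on 𝕋³ = Galilean frame (bridge).

## Architecture as printed (§1.2.5 p.19–20 seven steps; §20.2 p.330 Steps I–X; §20 Step 9 p.343) and the typed steps

Envelope ODE (1.8) → comparison U_k ≤ a_k (Lemma 12.15) → universal metric Y_e (1.13) → integrated
monotonicity (1.14) (Thm 11.41 / Prop 14.6) → KT logarithmic bound (Prop 11.38) → **Step IX p.330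
«Osgood criterion: Combining Steps VII–VIII yields d/dt‖u‖²_{H¹} ≤ −γ‖u‖²_{H¹} log(e + ‖u‖^{1/2}_{H¹})
with γ > 0. The Osgood lemma prevents finite-time blow-up (Lemma 11.10)»** = (1.15) p.19 «c > 0
universal» = (1.17) of Theorem 1.1 (with `‖u‖_{H¹}` inside the logarithm; §20 Step 9 p.343 runs an
integral variant (20.64) in the `Y_e` metric with a superlinear term `κỸ^{1+θ}`) → Step X p.330
«Global H¹ bound plus L²_tH²_x integrability implies Prodi–Serrin … smoothness; uniqueness» → §1.3.2
p.21 / §21 «Unconditional extension to ℝ³».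

ORDER OF RECORD (QUICK grain):
* Step 1 = `Step_osgood` — Step IX p.330 / (1.15) p.19 / (1.17) p.20 as the A-PRIORI statement it is
  derived as (Steps I–VIII «hold without assuming global regularity»): for every `ν > 0` there is
  `γ > 0` such that EVERY global classical solution on the unit torus with zero-mean datum obeys (1.17)
  at every `t > 0`.
* Step 2 = `Step_IXtoMain` — Steps IX–X p.330 + §20 Steps 9–10 pp.343–34x (Osgood lemma 11.10,
  Prodi–Serrin bootstrap, local theory): `Step_osgood → ClaimedTheoremT3`.
* Step 3 = `Step_R3ext` — §1.3.2 p.21 («extends immediately to the whole space … the envelope's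
  exponential localization (1.10) provides a dynamical spectral Poincaré inequality») / §21:
  `ClaimedTheoremT3 → ClaimedTheoremR3`.

COMPOSITION — PROVED, every step consumed: `claim_of_steps : Step_osgood → Step_IXtoMain → Step_R3ext →
ClaimedTheoremT3 ∧ ClaimedTheoremR3`. UNIQUENESS TRANSPORT — PROVED (tree forward uniqueness of
classical torus solutions, `Torus.IsClassicalNSSolutionOn.velocity_unique_of_mem`):
`step_osgood_of_claimedT3 : ClaimedTheoremT3 → Step_osgood` — the decay clause (1.17) of the claimed
theorem transfers to EVERY global classical zero-mean solution, so a kernel refutation of `Step_osgood`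
refutes `ClaimedTheoremT3` as printed (`not_claimedT3_of_not_osgood`).

Kernel handle recorded for the refuter (no verdict here): along the exact ABC/Beltrami solution
`e^{−4π²νt}·abcFlow A B C` (tree `Torus.isClassicalNSSolutionOn_abcFlow`, zero mean
`Torus.hasZeroMean_abcFlow`) one has `‖u(t)‖²_{H¹} = (1 + 4π²)(A² + B² + C²)e^{−8π²νt}`, so
`d/dt‖u‖²_{H¹} = −8π²ν‖u‖²_{H¹}`, while (1.17) demands a rate `≥ γ log(e + ‖u‖_{H¹})`, unbounded as the
amplitude grows: for fixed `ν, γ` a large-amplitude ABC datum violates (1.17) at small `t > 0`.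

WHAT THIS IS NOT: not a claim about NS regularity or blow-up; not a claim about any author beyond the
typed locator.
-/

open scoped ContDiff ENNReal
open _root_.MeasureTheory _root_.Set Function

namespace Literature.Claims.NS.Harbeck2025

open Literature.Analysis.FunctionSpaces Literature.Analysis.FluidPDE

noncomputable section

/-! ## A. Vocabulary -/

/-- The unit 3-torus (the paper's `𝕋³`; period immaterial by scaling). [cite: Harbeck2025, §1.4.1 p.24] -/
abbrev T3 : Type := UnitAddTorus (Fin 3)

/-- Physical space `ℝ³`. [cite: Harbeck2025, Theorem 1.4 p.21] -/
abbrev E3 : Type := EuclideanSpace ℝ (Fin 3)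

/-- The inhomogeneous `H¹` norm squared on the torus, `‖u‖²_{H¹} = ‖u‖²_{L²} + ‖∇u‖²_{L²}` (p.24:
`H^s(T³)` «the inhomogeneous Sobolev space»; the tree's `Torus.gradNormSq` for the gradient part).
[cite: Harbeck2025, §1.4.1 p.24] -/
def h1NormSq (u : T3 → E3) : ℝ :=
  (∫ x, ‖u x‖ ^ 2) + Torus.gradNormSq u

/-- **(1.17) p.20 along a trajectory** `u : ℝ → (T³ → ℝ³)` with constant `γ`: at every `t > 0`,
`d/dt ‖u‖²_{H¹} ≤ −γ ‖u‖²_{H¹} log(e + ‖u‖_{H¹})` (derivative = Mathlib `deriv` of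
`s ↦ ‖u(s)‖²_{H¹}`). [cite: Harbeck2025, Theorem 1.1 (1.17) p.20] -/
def OsgoodDecay (γ : ℝ) (u : ℝ → T3 → E3) : Prop :=
  ∀ t : ℝ, 0 < t →
    deriv (fun s => h1NormSq (u s)) t ≤
      -(γ * h1NormSq (u t) * Real.log (Real.exp 1 + Real.sqrt (h1NormSq (u t))))

/-! ## B. The claimed statements -/

/-- **Theorem 1.1 p.20 without its decay clause** (the (B)-shaped core, QUICK grain, smooth data): for
every `ν > 0`, every smooth divergence-free zero-mean datum on `𝕋³` has a global classical solution
on `[0,∞)`. [claim: Harbeck2025, status: disputed] -/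
def Thm11Existence : Prop :=
  ∀ ν : ℝ, 0 < ν → ∀ w₀ : T3 → E3, Torus.IsSmooth w₀ → Torus.IsDivFree w₀ → Torus.HasZeroMean w₀ →
    ∃ (W : ℝ → T3 → E3) (P : ℝ → T3 → ℝ), Torus.IsClassicalNSSolutionOn (Ici 0) ν 0 W P ∧ W 0 = w₀

/-- **Theorem 1.1 p.20 as printed, QUICK grain** (smooth data; clauses (i) L∞-part and (1.17) typed;
«universal constant γ > 0 (depending only on ν)» ⇒ `γ` chosen before the datum).
[claim: Harbeck2025, status: disputed] -/
def ClaimedTheoremT3 : Prop :=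
  ∀ ν : ℝ, 0 < ν → ∃ γ : ℝ, 0 < γ ∧
    ∀ w₀ : T3 → E3, Torus.IsSmooth w₀ → Torus.IsDivFree w₀ → Torus.HasZeroMean w₀ →
      ∃ (W : ℝ → T3 → E3) (P : ℝ → T3 → ℝ), Torus.IsClassicalNSSolutionOn (Ici 0) ν 0 W P ∧ W 0 = w₀ ∧
        (∃ M : ℝ, ∀ t : ℝ, 0 ≤ t → h1NormSq (W t) ≤ M) ∧ OsgoodDecay γ W

/-- **Theorem 1.4 p.21 at the Clay grain** (smooth divergence-free datum with `u₀, Du₀ ∈ L²(ℝ³)`, i.e.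
`H¹`, no decay assumed; conclusion: smooth `(u, p)` on `ℝ³ × [0,∞)` solving the unforced system with
datum `u₀` and bounded energy). [claim: Harbeck2025, status: disputed] -/
def ClaimedTheoremR3 : Prop :=
  ∀ ν : ℝ, 0 < ν → ∀ u₀ : E3 → E3, ContDiff ℝ ∞ u₀ → NSWave0.IsDivFree u₀ →
    (∀ n : ℕ, n ≤ 1 → (∫⁻ x, ‖iteratedFDeriv ℝ n u₀ x‖ₑ ^ 2) < (⊤ : ℝ≥0∞)) →
      ∃ (u : ℝ → E3 → E3) (p : ℝ → E3 → ℝ),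
        IsSmoothOnHalfSpace u ∧ IsSmoothOnHalfSpace p ∧ IsNavierStokesSolution ν 0 u₀ u p ∧
          HasBoundedEnergy u

/-! ## C. The steps -/

/-- **Step 1 — Step IX p.330 / (1.15) p.19 / (1.17) p.20, a priori**: for every `ν > 0` there is `γ > 0`
such that every global classical unforced solution on `𝕋³ × [0,∞)` with zero-mean datum satisfies
(1.17) at every `t > 0`. [claim: Harbeck2025, status: disputed] -/
def Step_osgood : Prop :=
  ∀ ν : ℝ, 0 < ν → ∃ γ : ℝ, 0 < γ ∧
    ∀ (u : ℝ → T3 → E3) (p : ℝ → T3 → ℝ), Torus.IsClassicalNSSolutionOn (Ici 0) ν 0 u p →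
      Torus.HasZeroMean (u 0) → OsgoodDecay γ u

/-- **Step 2 — Steps IX–X p.330, §20 Steps 9–10 pp.343 ff.** («The Osgood lemma prevents finite-time
blow-up (Lemma 11.10)»; «Global H¹ bound plus L²_tH²_x integrability implies Prodi–Serrin … smoothness;
uniqueness»), with the local theory: the a-priori decay law yields Theorem 1.1.
[claim: Harbeck2025, status: disputed] -/
def Step_IXtoMain : Prop :=
  Step_osgood → ClaimedTheoremT3

/-- **Step 3 — §1.3.2 p.21 / §21** («extends immediately to the whole space ℝ³ without requiring any
decay or compactness assumptions»): Theorem 1.1 yields Theorem 1.4.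
[claim: Harbeck2025, status: disputed] -/
def Step_R3ext : Prop :=
  ClaimedTheoremT3 → ClaimedTheoremR3

/-! ## D. Kernel-checked relations (pure logic + tree bridges; nothing of the paper is asserted) -/

/-- **COMPOSITION** — PROVED, every step consumed. [cite: Harbeck2025, §1.2.5 p.19–20, §20.2 p.330] -/
theorem claim_of_steps (h1 : Step_osgood) (h2 : Step_IXtoMain) (h3 : Step_R3ext) :
    ClaimedTheoremT3 ∧ ClaimedTheoremR3 :=
  ⟨h2 h1, h3 (h2 h1)⟩

/-- The decay clause dropped: Theorem 1.1 as typed gives the (B)-shaped core.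
[cite: Harbeck2025, Theorem 1.1 p.20] -/
theorem thm11_of_claimedT3 (h : ClaimedTheoremT3) : Thm11Existence := by
  intro ν hν w₀ hw hdiv hmean
  obtain ⟨γ, _, hall⟩ := h ν hν
  obtain ⟨W, P, hW, hW0, _, _⟩ := hall w₀ hw hdiv hmean
  exact ⟨W, P, hW, hW0⟩

/-- **Clay link (B)**: the (B)-shaped core implies Fefferman's (B) (tree bridge: lift to periodic fields
on `ℝ³` and Galilean normalisation of the mean). [cite: FeffermanClay2006, (B) p. 2] -/
theorem clayB_of_thm11 (h : Thm11Existence) : ClayVariants.clayPeriodic.Regularity :=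
  (ClayVariants.clayPeriodic_regularity_of_torus_meanZero h).1

/-- **Clay link (A)**: Theorem 1.4 as typed implies Fefferman's (A) — Clay data (4) are `H¹`.
[cite: FeffermanClay2006, (A) p. 2] -/
theorem clayA_of_claimedR3 (h : ClaimedTheoremR3) : ClayVariants.clayR3.Regularity := by
  intro ν hν u₀ hu₀ hdiv hdec
  have hH1 : ∀ n : ℕ, n ≤ 1 → (∫⁻ x, ‖iteratedFDeriv ℝ n u₀ x‖ₑ ^ 2) < (⊤ : ℝ≥0∞) :=
    fun n _ => hdec.lintegral_enorm_iteratedFDeriv_sq_lt_top (μ := (volume : Measure E3)) n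
  obtain ⟨u, p, hu, hp, hns, hE⟩ := h ν hν u₀ hu₀ hdiv hH1
  exact ⟨u, p, hu, hp, hns, hE⟩

/-- **UNIQUENESS TRANSPORT**: the decay clause (1.17) of Theorem 1.1 passes to EVERY global classical
zero-mean solution, by forward uniqueness of classical solutions on the torus
(`Torus.IsClassicalNSSolutionOn.velocity_unique_of_mem`): the theorem's solution from the datum `u(0)`
coincides with `u` on `[0,∞)`, hence has the same `H¹` history near every `t > 0`.
[cite: Harbeck2025, Theorem 1.1 (1.17) p.20] [cite: MajdaBertozziCUP2002, Cor. 3.1] -/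
theorem step_osgood_of_claimedT3 (h : ClaimedTheoremT3) : Step_osgood := by
  intro ν hν
  obtain ⟨γ, hγ, hall⟩ := h ν hν
  refine ⟨γ, hγ, fun u p hu hmean t ht => ?_⟩
  have hsm : Torus.IsSmooth (u 0) := hu.smooth_velocity.isSmooth_slice (mem_Ici.2 le_rfl)
  have hdf : Torus.IsDivFree (u 0) := hu.divFree 0 (mem_Ici.2 le_rfl)
  obtain ⟨W, P, hW, hW0, _, hdecay⟩ := hall (u 0) hsm hdf hmean
  -- forward uniqueness: `W = u` on `[0, ∞)`
  have heq : ∀ s : ℝ, 0 ≤ s → W s = u s := fun s hs =>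
    hW.velocity_unique_of_mem hν.le (convex_Ici 0) hu (mem_Ici.2 le_rfl) hW0 (mem_Ici.2 hs) hs
  -- the two `H¹` histories agree near `t > 0`, so their derivatives at `t` agree
  have hev : (fun s => h1NormSq (W s)) =ᶠ[nhds t] fun s => h1NormSq (u s) := by
    filter_upwards [Ioi_mem_nhds ht] with s hs
    rw [heq s (le_of_lt hs)]
  have hder : deriv (fun s => h1NormSq (W s)) t = deriv (fun s => h1NormSq (u s)) t :=
    hev.deriv_eq
  have := hdecay t ht
  rw [hder, heq t ht.le] at this
  exact this

/-- Hence a refutation of the a-priori decay law refutes Theorem 1.1 as printed.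
[cite: Harbeck2025, Theorem 1.1 (1.17) p.20] -/
theorem not_claimedT3_of_not_osgood (h : ¬ Step_osgood) : ¬ ClaimedTheoremT3 :=
  fun hc => h (step_osgood_of_claimedT3 hc)

end

end Literature.Claims.NS.Harbeck2025
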